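import Mathlib
import HarnessLib
import Summits.HubbardSuperconductivity.HubbardSuperconductivity.Theorems.KLProgrammeKLRegimeFlowReadResidueSplit
import Summits.HubbardSuperconductivity.HubbardSuperconductivity.Theorems.KLProgrammeKLRegimeTwoLegReadOscConsts
import Summits.HubbardSuperconductivity.HubbardSuperconductivity.Theorems.KLProgrammeC4aReadJetAssembly

/-!
# Route `KLProgramme`, crux K3 — gen-8 ENGINE-FLOW child (stmt-HubbardSuperconductivity-20437 `KLRegimeEngineV17F2`), stub (C)
# `stub_twoLeg_curvature`, v2 text (token #26): the (P)-side ASSEMBLY of the appended mean-free VALUE conjunct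
# `TwoLegReadOscAt L M (klReadOscC P R) β U μ K_n n` — «(P)-OSC»

Seat hubbard-kl-k3c3-p1 (g10; row «δμ-flow with klAngularMean constant piece»).  The v2 registered text of stub (C) (p1b rev-11 image
f0b09aba13014b81) concludes `TwoLegReadJetBound … ∧ TwoLegReadOscAt L M (klReadOscC P R) β U μ (klFlowFrameU … n) n`, the second conjunct being
the MEAN-FREE value clause `|ν_n(K_n)(θ) − klAngularMean ν_n(K_n)| ≤ c″·U²·4^{−2n}` (r2d-p1, `…SplitFlowPieceOscDefs`; c4a-1's constant `klReadOscC`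
and PRODUCER door `twoLegReadOscAt_klReadOscC_of_abs_sub_const_le`: a reading within `klC4aJetC′ P R 0·U²·4^{−2n}` of SOME constant satisfies it).
How the per-scale proof of stub (C) reaches that producer door — the bookkeeping this file types, once:

* at scale `n+1`, `ν_{n+1}(K_{n+1}) = δ_{n+1}(K_{n+1}) + ν_n(K_{n+1})` (`C4a.klLocalPart_succ_eq_profile_add`) and the RESIDUE
  `ν_n(K_{n+1}) = (B) + (C2) + (C1)` (k3c3-p3's `klLocalPart_flow_residue_split`: frame response + transport + Jackson remainder);
* the (A) increment is STRUCTURED at order 0: `δ_{n+1}(K_{n+1})(θ) = τ_A + r(θ)`, `τ_A` the θ-CONSTANT first-order (tadpole) value, `|r| ≤ a·U²·4^{−2(n+1)}`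
  (c4a-1's value layer `…C4aTubeTadpoleValue`, `tubeTadpole_const_vertex`);
* the three doors' `k = 0` rows are USABLE for the mean-free clause iff they are pure `U²·16^{−(n+1)}` currency, i.e. their `curveJetBar` table has ZERO
  un-primed `k = 0` entry (`e 0 = 0`: then `curveJetBar e e′ U 0 m = e′0·U²·4^{−2m}`, §1) — true for (C1) (`…ReadResidueC1Fit`: `eJ 0 = 0`) and (C2)
  (`…FlowReadTransportFit`: `curveJetBar (fun _ => 0) eT′`), and for (B) as soon as its value row is booked in the primed column (every (B) term carries
  the frame distance `‖p_n‖ = O(|U|·16^{−n})`); a STRUCTURED (B) row `τ_B + remainder` is also accepted (§2).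
The mean-free clause is NOT inherited from the previous scale's clause (that would cost `16×` the budget): it is re-assembled at every scale from
(A)-structured + the residue's value, and the SAME structured estimate gives the `k = 0` VALUE clause of the jets conjunct at any private table (§3).

* §1 `curveJetBar_zero_split` (`k = 0` bar = `c₀|U|4^{−2m} + c′₀U²4^{−2m}`), `abs_le_of_curveJetBar_zero_of_fst_eq_zero`;
* §2 THE STRUCTURED RESIDUE DOOR `readResidue_structured_of_doors` (generic frames `K₀`, `K₀ ⊖ p`), `readResidue_flow_structured` (flow instance under
  `4·klFlowDeg (n+1) ≤ L`), `readResidue_flow_osc_of_hP` (the `e 0 = 0` corollary of `readResidue_flow_hP`'s own output: `|ν_n(K_{n+1})| ≤ e′0·U²·4^{−2(n+1)}`);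
* §3 THE ASSEMBLY: `abs_klLocalPart_succ_sub_const_le` (any frame), `twoLegReadOscAt_succ_of_structured` (`a + p ≤ c″/2`),
  `twoLegReadOscAt_flow_succ_of_structured_klReadOscC` (`a + p ≤ klC4aJetC′ P R 0`), `twoLegReadOscAt_flow_succ_of_hP_klReadOscC` (keyed by
  `readResidue_flow_hP`'s output + `e 0 = 0`), and `abs_klLocalPart_le_curveJetBar_zero_of_structured_table` (the `k = 0` value clause at ANY table
  `(cc, cc′)` from `|τ| ≤ cc 0·|U|·4^{−2m}` and the structured remainder `≤ cc′ 0·U²·4^{−2m}`);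
* §4 scale `0` (`K₀ = 0`, `ν₀(0) = δ₀(0)`): `twoLegReadOscAt_zero_of_structured(_klReadOscC)`.

Bookkeeping only (triangle inequalities on the tree's identities); no definition; nothing here asserts any stub of 20437, K3 or superconductivity.
References: BGM 2006 §2.4 (2.36) [cite: BenfattoGiulianiMastropietro2006] (`C₀|U|` value law: the first-order tadpole is momentum-independent).
-/

noncomputable section

namespace Summit.HubbardSuperconductivity.HubbardSuperconductivity.Theorems.KLRegimeSplit

set_option linter.dupNamespace false -- summit = problem name (single-conjunct summit), D-0017

open Real Literature.MathematicalPhysics.QuantumLattice Literature.Probability.LatticeModels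
open Literature.MathematicalPhysics.QuantumLattice.FermiRG

/-! ## §1 The `k = 0` bar: pure `U²` currency iff the un-primed entry vanishes -/

/-- The `k = 0` curve-jet bar splits as first-order budget + second-order budget: `c₀·|U|·4^{−2m} + c′₀·U²·4^{−2m}`. -/
theorem curveJetBar_zero_split (c c' : ℕ → ℝ) (U : ℝ) (m : ℕ) :
    curveJetBar c c' U 0 m = c 0 * |U| * (4 : ℝ) ^ (-2 * (m : ℤ)) + c' 0 * U ^ 2 * (4 : ℝ) ^ (-2 * (m : ℤ)) := by
  rw [curveJetBar_apply, uPow_zero, ← sq_abs U]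
  push_cast
  ring

/-- With ZERO un-primed `k = 0` entry the bar is pure `U²` currency: `curveJetBar c c′ U 0 m = c′₀·U²·4^{−2m}`. -/
theorem curveJetBar_zero_of_fst_eq_zero {c : ℕ → ℝ} (hc : c 0 = 0) (c' : ℕ → ℝ) (U : ℝ) (m : ℕ) :
    curveJetBar c c' U 0 m = c' 0 * U ^ 2 * (4 : ℝ) ^ (-2 * (m : ℤ)) := by
  rw [curveJetBar_zero_split, hc, zero_mul, zero_mul, zero_add]

/-- A `k = 0` door bound with zero un-primed entry, read in the mean-free clause's currency. -/
theorem abs_le_of_curveJetBar_zero_of_fst_eq_zero {x U : ℝ} {c c' : ℕ → ℝ} {m : ℕ} (hc : c 0 = 0) (h : |x| ≤ curveJetBar c c' U 0 m) :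
    |x| ≤ c' 0 * U ^ 2 * (4 : ℝ) ^ (-2 * (m : ℤ)) := by
  rwa [curveJetBar_zero_of_fst_eq_zero hc] at h

/-- `0 ≤ U²·4^{−2m}` (the common factor of the clause). -/
theorem sq_mul_four_zpow_nonneg (U : ℝ) (m : ℕ) : 0 ≤ U ^ 2 * (4 : ℝ) ^ (-2 * (m : ℤ)) :=
  mul_nonneg (sq_nonneg U) (zpow_nonneg (by norm_num) _)

/-! ## §2 The structured residue door: (B) structured + (C2) + (C1) -/

section Model

variable {L M : ℕ} [NeZero L] [NeZero M]

/-- **STRUCTURED RESIDUE DOOR (generic frames)**: for frames `K₀`, `K = K₀ ⊖ p` of degree `≤ L/2`, if the frame response (B) is within `b` of a constant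
`τ` and the transport (C2) and the Jackson remainder (C1) are bounded by `t`, `j` (all at the angle `θ`), then the old reading on the new frame is within
`b + t + j` of `τ`: `|ν_n(K)(θ) − τ| ≤ b + t + j`. -/
theorem readResidue_structured_of_doors (β U μ : ℝ) {K₀ p : TrigPolyC4v} (hK₀ : K₀.degree ≤ L / 2) (hK : (fsub K₀ p).degree ≤ L / 2) (n : ℕ)
    {τ b t j : ℝ} {θ : ℝ}
    (hB : |((symInterp L (fun k => klLocSelfEnergyRe L M β U μ (fsub K₀ p) n k - (fsub K₀ p).eval (latticeMomentum L k))).eval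
            (klFermiPoint μ (fsub K₀ p) θ) -
          (symInterp L (fun k => klLocSelfEnergyRe L M β U μ K₀ n k - K₀.eval (latticeMomentum L k))).eval (klFermiPoint μ (fsub K₀ p) θ)) - τ| ≤ b)
    (hT : |(symInterp L (klLocSelfEnergyRe L M β U μ K₀ n)).eval (klFermiPoint μ (fsub K₀ p) θ) - klLocalPart L M β U μ K₀ n θ| ≤ t)
    (hJ : |klLocalPart L M β U μ K₀ n θ - p.eval (klFermiPoint μ (fsub K₀ p) θ)| ≤ j) :
    |klLocalPart L M β U μ (fsub K₀ p) n θ - τ| ≤ b + t + j := by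
  rw [klLocalPart_residue_split β U μ hK₀ hK n θ]
  set B := (symInterp L (fun k => klLocSelfEnergyRe L M β U μ (fsub K₀ p) n k - (fsub K₀ p).eval (latticeMomentum L k))).eval
        (klFermiPoint μ (fsub K₀ p) θ) -
      (symInterp L (fun k => klLocSelfEnergyRe L M β U μ K₀ n k - K₀.eval (latticeMomentum L k))).eval (klFermiPoint μ (fsub K₀ p) θ)
  set T := (symInterp L (klLocSelfEnergyRe L M β U μ K₀ n)).eval (klFermiPoint μ (fsub K₀ p) θ) - klLocalPart L M β U μ K₀ n θ
  set J := klLocalPart L M β U μ K₀ n θ - p.eval (klFermiPoint μ (fsub K₀ p) θ)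
  calc |B + T + J - τ| = |(B - τ) + T + J| := by ring_nf
    _ ≤ |B - τ| + |T| + |J| := abs_add_three _ _ _
    _ ≤ b + t + j := add_le_add (add_le_add hB hT) hJ

/-- **STRUCTURED RESIDUE DOOR, flow instance** (`K₀ = K_n`, `p = klFlowPiece n`, `K = K_{n+1}`, volume guard `4·klFlowDeg (n+1) ≤ L`), in the mean-free
clause's currency at scale `n+1`: (B) within `b·U²·4^{−2(n+1)}` of a constant `τ`, `|(C2)| ≤ t·U²·4^{−2(n+1)}`, `|(C1)| ≤ j·U²·4^{−2(n+1)}` ⟹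
`|ν_n(K_{n+1})(θ) − τ| ≤ (b + t + j)·U²·4^{−2(n+1)}`. -/
theorem readResidue_flow_structured (β U μ : ℝ) {n : ℕ} (hL : 4 * klFlowDeg (n + 1) ≤ L) {τ b t j : ℝ}
    (hB : ∀ θ : ℝ, |((symInterp L (fun k => klLocSelfEnergyRe L M β U μ (klFlowFrameU L M β U μ (n + 1)) n k -
              (klFlowFrameU L M β U μ (n + 1)).eval (latticeMomentum L k))).eval (klFermiPoint μ (klFlowFrameU L M β U μ (n + 1)) θ) -
          (symInterp L (fun k => klLocSelfEnergyRe L M β U μ (klFlowFrameU L M β U μ n) n k -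
              (klFlowFrameU L M β U μ n).eval (latticeMomentum L k))).eval (klFermiPoint μ (klFlowFrameU L M β U μ (n + 1)) θ)) - τ| ≤
        b * U ^ 2 * (4 : ℝ) ^ (-2 * ((n + 1 : ℕ) : ℤ)))
    (hT : ∀ θ : ℝ, |(symInterp L (klLocSelfEnergyRe L M β U μ (klFlowFrameU L M β U μ n) n)).eval (klFermiPoint μ (klFlowFrameU L M β U μ (n + 1)) θ) -
        klLocalPart L M β U μ (klFlowFrameU L M β U μ n) n θ| ≤ t * U ^ 2 * (4 : ℝ) ^ (-2 * ((n + 1 : ℕ) : ℤ)))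
    (hJ : ∀ θ : ℝ, |klLocalPart L M β U μ (klFlowFrameU L M β U μ n) n θ -
        (klFlowPiece L M β U μ n).eval (klFermiPoint μ (klFlowFrameU L M β U μ (n + 1)) θ)| ≤ j * U ^ 2 * (4 : ℝ) ^ (-2 * ((n + 1 : ℕ) : ℤ)))
    (θ : ℝ) :
    |klLocalPart L M β U μ (klFlowFrameU L M β U μ (n + 1)) n θ - τ| ≤ (b + t + j) * U ^ 2 * (4 : ℝ) ^ (-2 * ((n + 1 : ℕ) : ℤ)) := by
  obtain ⟨h0, h1⟩ := degree_klFlowFrameU_le_half (L := L) (M := M) (β := β) (U := U) (μ := μ) hL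
  rw [klFlowFrameU_succ] at h1 hB hT hJ ⊢
  have h := readResidue_structured_of_doors β U μ h0 h1 n (hB θ) (hT θ) (hJ θ)
  calc _ ≤ _ := h
    _ = (b + t + j) * U ^ 2 * (4 : ℝ) ^ (-2 * ((n + 1 : ℕ) : ℤ)) := by ring

/-- **The `e 0 = 0` corollary of `readResidue_flow_hP`'s own output**: if the residue `θ ↦ ν_n(K_{n+1})(θ)` obeys `|∂ᵏ·| ≤ curveJetBar e e′ U k (n+1)` (`k ≤ 4`)
with ZERO un-primed `k = 0` entry, then `|ν_n(K_{n+1})(θ)| ≤ e′0·U²·4^{−2(n+1)}` — the residue is within that of the constant `0`. -/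
theorem readResidue_flow_osc_of_hP (β U μ : ℝ) {n : ℕ} {e e' : ℕ → ℝ}
    (hP : ∀ k ≤ 4, ∀ θ : ℝ, |iteratedDeriv k (fun θ : ℝ => klLocalPart L M β U μ (klFlowFrameU L M β U μ (n + 1)) n θ) θ| ≤
      curveJetBar e e' U k (n + 1)) (he : e 0 = 0) (θ : ℝ) :
    |klLocalPart L M β U μ (klFlowFrameU L M β U μ (n + 1)) n θ - 0| ≤ e' 0 * U ^ 2 * (4 : ℝ) ^ (-2 * ((n + 1 : ℕ) : ℤ)) := by
  rw [sub_zero]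
  have h := hP 0 (Nat.zero_le _) θ
  rw [iteratedDeriv_zero] at h
  exact abs_le_of_curveJetBar_zero_of_fst_eq_zero he h

/-! ## §3 The assembly at scale `n + 1`: (A) structured + (P) structured ⇒ the mean-free clause and the `k = 0` value clause -/

/-- **Increment + residue, structured** (any frame `K`): `|δ_{n+1}(K)(θ) − τ_A| ≤ a` and `|ν_n(K)(θ) − τ_P| ≤ p` give
`|ν_{n+1}(K)(θ) − (τ_A + τ_P)| ≤ a + p`. -/
theorem abs_klLocalPart_succ_sub_const_le {β U μ : ℝ} {K : TrigPolyC4v} {n : ℕ} {τA τP a p : ℝ} {θ : ℝ}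
    (hA : |klTwoLegCurveProfile L M β U μ K (n + 1) θ - τA| ≤ a) (hP : |klLocalPart L M β U μ K n θ - τP| ≤ p) :
    |klLocalPart L M β U μ K (n + 1) θ - (τA + τP)| ≤ a + p := by
  have h : klLocalPart L M β U μ K (n + 1) θ - (τA + τP) =
      (klTwoLegCurveProfile L M β U μ K (n + 1) θ - τA) + (klLocalPart L M β U μ K n θ - τP) := by
    simp only [klTwoLegCurveProfile_succ]
    ring
  rw [h]
  exact (abs_add_le _ _).trans (add_le_add hA hP)

/-- **THE MEAN-FREE CLAUSE AT SCALE `n+1` FROM STRUCTURED DATA** (any frame `K`, any constant `c″`): the reading `ν_{n+1}(K)` continuous, the increment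
within `a·U²·4^{−2(n+1)}` of a constant, the previous-scale reading on the same frame within `p·U²·4^{−2(n+1)}` of a constant, `a + p ≤ c″/2` ⟹
`TwoLegReadOscAt L M c″ β U μ K (n+1)`. -/
theorem twoLegReadOscAt_succ_of_structured {c'' β U μ : ℝ} {K : TrigPolyC4v} {n : ℕ} {τA τP a p : ℝ}
    (hcont : Continuous fun θ : ℝ => klLocalPart L M β U μ K (n + 1) θ)
    (hA : ∀ θ : ℝ, |klTwoLegCurveProfile L M β U μ K (n + 1) θ - τA| ≤ a * U ^ 2 * (4 : ℝ) ^ (-2 * ((n + 1 : ℕ) : ℤ)))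
    (hP : ∀ θ : ℝ, |klLocalPart L M β U μ K n θ - τP| ≤ p * U ^ 2 * (4 : ℝ) ^ (-2 * ((n + 1 : ℕ) : ℤ)))
    (hfit : a + p ≤ c'' / 2) :
    TwoLegReadOscAt L M c'' β U μ K (n + 1) := by
  refine twoLegReadOscAt_of_abs_sub_const_le hcont (τA + τP) fun θ => ?_
  have hnn := sq_mul_four_zpow_nonneg U (n + 1)
  calc |klLocalPart L M β U μ K (n + 1) θ - (τA + τP)|
      ≤ a * U ^ 2 * (4 : ℝ) ^ (-2 * ((n + 1 : ℕ) : ℤ)) + p * U ^ 2 * (4 : ℝ) ^ (-2 * ((n + 1 : ℕ) : ℤ)) :=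
        abs_klLocalPart_succ_sub_const_le (hA θ) (hP θ)
    _ = (a + p) * (U ^ 2 * (4 : ℝ) ^ (-2 * ((n + 1 : ℕ) : ℤ))) := by ring
    _ ≤ c'' / 2 * (U ^ 2 * (4 : ℝ) ^ (-2 * ((n + 1 : ℕ) : ℤ))) := mul_le_mul_of_nonneg_right hfit hnn
    _ = c'' / 2 * U ^ 2 * (4 : ℝ) ^ (-2 * ((n + 1 : ℕ) : ℤ)) := by ring

/-- The same with continuity read from a reading-jet predicate `TwoLegReadJetBound … K (n+1)` (stub (C)'s first conjunct, any table). -/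
theorem twoLegReadOscAt_succ_of_structured_of_readJetBound {c'' β U μ : ℝ} {K : TrigPolyC4v} {n : ℕ} {τA τP a p : ℝ} {cc cc' : ℕ → ℝ}
    (hR : TwoLegReadJetBound L M cc cc' β U μ K (n + 1))
    (hA : ∀ θ : ℝ, |klTwoLegCurveProfile L M β U μ K (n + 1) θ - τA| ≤ a * U ^ 2 * (4 : ℝ) ^ (-2 * ((n + 1 : ℕ) : ℤ)))
    (hP : ∀ θ : ℝ, |klLocalPart L M β U μ K n θ - τP| ≤ p * U ^ 2 * (4 : ℝ) ^ (-2 * ((n + 1 : ℕ) : ℤ)))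
    (hfit : a + p ≤ c'' / 2) :
    TwoLegReadOscAt L M c'' β U μ K (n + 1) :=
  twoLegReadOscAt_succ_of_structured hR.1.continuous hA hP hfit

/-- **At the token-#26 constant**: `a + p ≤ klC4aJetC′ P R 0` ⟹ `TwoLegReadOscAt L M (klReadOscC P R) β U μ K (n+1)`. -/
theorem twoLegReadOscAt_succ_of_structured_klReadOscC {P : SplitConsts} {R : RenConsts} {β U μ : ℝ} {K : TrigPolyC4v} {n : ℕ}
    {τA τP a p : ℝ} (hcont : Continuous fun θ : ℝ => klLocalPart L M β U μ K (n + 1) θ)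
    (hA : ∀ θ : ℝ, |klTwoLegCurveProfile L M β U μ K (n + 1) θ - τA| ≤ a * U ^ 2 * (4 : ℝ) ^ (-2 * ((n + 1 : ℕ) : ℤ)))
    (hP : ∀ θ : ℝ, |klLocalPart L M β U μ K n θ - τP| ≤ p * U ^ 2 * (4 : ℝ) ^ (-2 * ((n + 1 : ℕ) : ℤ)))
    (hfit : a + p ≤ klC4aJetC' P R 0) :
    TwoLegReadOscAt L M (klReadOscC P R) β U μ K (n + 1) :=
  twoLegReadOscAt_succ_of_structured hcont hA hP (by rw [klReadOscC_div_two]; exact hfit)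

/-- **THE FLOW INSTANCE FROM THE DOORS** (`K = K_{n+1}`): (A) structured at `K_{n+1}`, (B) structured, (C2), (C1) in `U²·4^{−2(n+1)}` currency, the reading
continuous, and the fit `a + (b + t + j) ≤ klC4aJetC′ P R 0` ⟹ the v2 conjunct `TwoLegReadOscAt L M (klReadOscC P R) β U μ K_{n+1} (n+1)`. -/
theorem twoLegReadOscAt_flow_succ_of_doors_klReadOscC {P : SplitConsts} {R : RenConsts} (β U μ : ℝ) {n : ℕ} (hL : 4 * klFlowDeg (n + 1) ≤ L)
    {τA τB a b t j : ℝ}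
    (hcont : Continuous fun θ : ℝ => klLocalPart L M β U μ (klFlowFrameU L M β U μ (n + 1)) (n + 1) θ)
    (hA : ∀ θ : ℝ, |klTwoLegCurveProfile L M β U μ (klFlowFrameU L M β U μ (n + 1)) (n + 1) θ - τA| ≤
      a * U ^ 2 * (4 : ℝ) ^ (-2 * ((n + 1 : ℕ) : ℤ)))
    (hB : ∀ θ : ℝ, |((symInterp L (fun k => klLocSelfEnergyRe L M β U μ (klFlowFrameU L M β U μ (n + 1)) n k -
              (klFlowFrameU L M β U μ (n + 1)).eval (latticeMomentum L k))).eval (klFermiPoint μ (klFlowFrameU L M β U μ (n + 1)) θ) -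
          (symInterp L (fun k => klLocSelfEnergyRe L M β U μ (klFlowFrameU L M β U μ n) n k -
              (klFlowFrameU L M β U μ n).eval (latticeMomentum L k))).eval (klFermiPoint μ (klFlowFrameU L M β U μ (n + 1)) θ)) - τB| ≤
        b * U ^ 2 * (4 : ℝ) ^ (-2 * ((n + 1 : ℕ) : ℤ)))
    (hT : ∀ θ : ℝ, |(symInterp L (klLocSelfEnergyRe L M β U μ (klFlowFrameU L M β U μ n) n)).eval (klFermiPoint μ (klFlowFrameU L M β U μ (n + 1)) θ) -
        klLocalPart L M β U μ (klFlowFrameU L M β U μ n) n θ| ≤ t * U ^ 2 * (4 : ℝ) ^ (-2 * ((n + 1 : ℕ) : ℤ)))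
    (hJ : ∀ θ : ℝ, |klLocalPart L M β U μ (klFlowFrameU L M β U μ n) n θ -
        (klFlowPiece L M β U μ n).eval (klFermiPoint μ (klFlowFrameU L M β U μ (n + 1)) θ)| ≤ j * U ^ 2 * (4 : ℝ) ^ (-2 * ((n + 1 : ℕ) : ℤ)))
    (hfit : a + (b + t + j) ≤ klC4aJetC' P R 0) :
    TwoLegReadOscAt L M (klReadOscC P R) β U μ (klFlowFrameU L M β U μ (n + 1)) (n + 1) :=
  twoLegReadOscAt_succ_of_structured_klReadOscC hcont hA (readResidue_flow_structured β U μ hL hB hT hJ) hfit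

/-- **THE FLOW INSTANCE KEYED BY `readResidue_flow_hP`'s OUTPUT** (the closer already holds it for the jets conjunct): (A) structured at `K_{n+1}`, the
residue's `curveJetBar e e′` jets with `e 0 = 0`, the reading continuous, `a + e′ 0 ≤ klC4aJetC′ P R 0` ⟹ the v2 conjunct at `K_{n+1}`. -/
theorem twoLegReadOscAt_flow_succ_of_hP_klReadOscC {P : SplitConsts} {R : RenConsts} (β U μ : ℝ) {n : ℕ} {τA a : ℝ} {e e' : ℕ → ℝ}
    (hcont : Continuous fun θ : ℝ => klLocalPart L M β U μ (klFlowFrameU L M β U μ (n + 1)) (n + 1) θ)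
    (hA : ∀ θ : ℝ, |klTwoLegCurveProfile L M β U μ (klFlowFrameU L M β U μ (n + 1)) (n + 1) θ - τA| ≤
      a * U ^ 2 * (4 : ℝ) ^ (-2 * ((n + 1 : ℕ) : ℤ)))
    (hP : ∀ k ≤ 4, ∀ θ : ℝ, |iteratedDeriv k (fun θ : ℝ => klLocalPart L M β U μ (klFlowFrameU L M β U μ (n + 1)) n θ) θ| ≤
      curveJetBar e e' U k (n + 1)) (he : e 0 = 0)
    (hfit : a + e' 0 ≤ klC4aJetC' P R 0) :
    TwoLegReadOscAt L M (klReadOscC P R) β U μ (klFlowFrameU L M β U μ (n + 1)) (n + 1) :=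
  twoLegReadOscAt_succ_of_structured_klReadOscC hcont hA (readResidue_flow_osc_of_hP β U μ hP he) hfit

/-- **The `k = 0` VALUE clause at ANY table from the same structured estimate**: `|ν_m(K)(θ) − τ| ≤ cc′ 0·U²·4^{−2m}` with the first-order budget
`|τ| ≤ cc 0·|U|·4^{−2m}` ⟹ `|ν_m(K)(θ)| ≤ curveJetBar cc cc′ U 0 m` (c4a-1's `abs_klLocalPart_le_curveJetBar_zero_of_structured` is the instance
`(cc, cc′) = (klC4aJetC, klC4aJetC′ P R)`; the closer's private tables need the general one). -/
theorem abs_klLocalPart_le_curveJetBar_zero_of_structured_table {β U μ : ℝ} {K : TrigPolyC4v} {m : ℕ} {cc cc' : ℕ → ℝ}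
    (τ : ℝ) (hτ : |τ| ≤ cc 0 * |U| * (4 : ℝ) ^ (-2 * (m : ℤ)))
    (h : ∀ θ : ℝ, |klLocalPart L M β U μ K m θ - τ| ≤ cc' 0 * U ^ 2 * (4 : ℝ) ^ (-2 * (m : ℤ))) (θ : ℝ) :
    |klLocalPart L M β U μ K m θ| ≤ curveJetBar cc cc' U 0 m := by
  rw [curveJetBar_zero_split]
  calc |klLocalPart L M β U μ K m θ| = |τ + (klLocalPart L M β U μ K m θ - τ)| := by ring_nf
    _ ≤ |τ| + |klLocalPart L M β U μ K m θ - τ| := abs_add_le _ _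
    _ ≤ _ := add_le_add hτ (h θ)

/-- **Both `k = 0` clauses of stub (C) at scale `n+1` from ONE structured estimate** (any frame `K`, private table `(cc, cc′)`, constant `c″`):
increment within `a·U²4^{−2(n+1)}` of `τ_A`, previous reading within `p·U²4^{−2(n+1)}` of `τ_P`, `|τ_A + τ_P| ≤ cc 0·|U|·4^{−2(n+1)}`,
`a + p ≤ cc′ 0` and `a + p ≤ c″/2` ⟹ the value clause `|ν_{n+1}(K)| ≤ curveJetBar cc cc′ U 0 (n+1)` AND `TwoLegReadOscAt L M c″ β U μ K (n+1)`. -/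
theorem value_and_osc_succ_of_structured {c'' β U μ : ℝ} {K : TrigPolyC4v} {n : ℕ} {τA τP a p : ℝ} {cc cc' : ℕ → ℝ}
    (hcont : Continuous fun θ : ℝ => klLocalPart L M β U μ K (n + 1) θ)
    (hA : ∀ θ : ℝ, |klTwoLegCurveProfile L M β U μ K (n + 1) θ - τA| ≤ a * U ^ 2 * (4 : ℝ) ^ (-2 * ((n + 1 : ℕ) : ℤ)))
    (hP : ∀ θ : ℝ, |klLocalPart L M β U μ K n θ - τP| ≤ p * U ^ 2 * (4 : ℝ) ^ (-2 * ((n + 1 : ℕ) : ℤ)))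
    (hτ : |τA + τP| ≤ cc 0 * |U| * (4 : ℝ) ^ (-2 * ((n + 1 : ℕ) : ℤ))) (hfit : a + p ≤ cc' 0) (hfit'' : a + p ≤ c'' / 2) :
    (∀ θ : ℝ, |klLocalPart L M β U μ K (n + 1) θ| ≤ curveJetBar cc cc' U 0 (n + 1)) ∧ TwoLegReadOscAt L M c'' β U μ K (n + 1) := by
  have hnn := sq_mul_four_zpow_nonneg U (n + 1)
  have hstr : ∀ θ : ℝ, |klLocalPart L M β U μ K (n + 1) θ - (τA + τP)| ≤ cc' 0 * U ^ 2 * (4 : ℝ) ^ (-2 * ((n + 1 : ℕ) : ℤ)) := fun θ =>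
    calc |klLocalPart L M β U μ K (n + 1) θ - (τA + τP)|
        ≤ a * U ^ 2 * (4 : ℝ) ^ (-2 * ((n + 1 : ℕ) : ℤ)) + p * U ^ 2 * (4 : ℝ) ^ (-2 * ((n + 1 : ℕ) : ℤ)) :=
          abs_klLocalPart_succ_sub_const_le (hA θ) (hP θ)
      _ = (a + p) * (U ^ 2 * (4 : ℝ) ^ (-2 * ((n + 1 : ℕ) : ℤ))) := by ring
      _ ≤ cc' 0 * (U ^ 2 * (4 : ℝ) ^ (-2 * ((n + 1 : ℕ) : ℤ))) := mul_le_mul_of_nonneg_right hfit hnn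
      _ = cc' 0 * U ^ 2 * (4 : ℝ) ^ (-2 * ((n + 1 : ℕ) : ℤ)) := by ring
  exact ⟨abs_klLocalPart_le_curveJetBar_zero_of_structured_table (τA + τP) hτ hstr,
    twoLegReadOscAt_succ_of_structured hcont hA hP hfit''⟩

/-! ## §4 Scale `0`: the bare frame, `ν₀(0) = δ₀(0)` -/

/-- **THE MEAN-FREE CLAUSE AT SCALE `0`** (`K₀ = 0`): the scale-`0` profile `δ₀(0) = ν₀(0)` continuous and within `a·U²` of a constant (`4^{−2·0} = 1`),
`a ≤ c″/2` ⟹ `TwoLegReadOscAt L M c″ β U μ (klFlowFrameU … 0) 0`. -/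
theorem twoLegReadOscAt_zero_of_structured {c'' β U μ : ℝ} {τ a : ℝ}
    (hcont : Continuous fun θ : ℝ => klLocalPart L M β U μ 0 0 θ)
    (hA : ∀ θ : ℝ, |klTwoLegCurveProfile L M β U μ 0 0 θ - τ| ≤ a * U ^ 2) (hfit : a ≤ c'' / 2) :
    TwoLegReadOscAt L M c'' β U μ (klFlowFrameU L M β U μ 0) 0 := by
  rw [klFlowFrameU_zero]
  refine twoLegReadOscAt_of_abs_sub_const_le hcont τ fun θ => ?_
  rw [C4a.klLocalPart_zero_frame_eq_profile β U μ θ]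
  calc _ ≤ a * U ^ 2 := hA θ
    _ ≤ c'' / 2 * U ^ 2 := mul_le_mul_of_nonneg_right hfit (sq_nonneg U)
    _ = c'' / 2 * U ^ 2 * (4 : ℝ) ^ (-2 * ((0 : ℕ) : ℤ)) := by norm_num

/-- Scale `0` at the token-#26 constant: `a ≤ klC4aJetC′ P R 0` ⟹ `TwoLegReadOscAt L M (klReadOscC P R) β U μ (klFlowFrameU … 0) 0`. -/
theorem twoLegReadOscAt_zero_of_structured_klReadOscC {P : SplitConsts} {R : RenConsts} {β U μ : ℝ} {τ a : ℝ}
    (hcont : Continuous fun θ : ℝ => klLocalPart L M β U μ 0 0 θ)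
    (hA : ∀ θ : ℝ, |klTwoLegCurveProfile L M β U μ 0 0 θ - τ| ≤ a * U ^ 2) (hfit : a ≤ klC4aJetC' P R 0) :
    TwoLegReadOscAt L M (klReadOscC P R) β U μ (klFlowFrameU L M β U μ 0) 0 :=
  twoLegReadOscAt_zero_of_structured hcont hA (by rw [klReadOscC_div_two]; exact hfit)

/-- **Both `k = 0` clauses at scale `0` from ONE structured estimate** (private table `(cc, cc′)`, constant `c″`). -/
theorem value_and_osc_zero_of_structured {c'' β U μ : ℝ} {τ a : ℝ} {cc cc' : ℕ → ℝ}
    (hcont : Continuous fun θ : ℝ => klLocalPart L M β U μ 0 0 θ)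
    (hA : ∀ θ : ℝ, |klTwoLegCurveProfile L M β U μ 0 0 θ - τ| ≤ a * U ^ 2) (hτ : |τ| ≤ cc 0 * |U|) (hfit : a ≤ cc' 0)
    (hfit'' : a ≤ c'' / 2) :
    (∀ θ : ℝ, |klLocalPart L M β U μ (klFlowFrameU L M β U μ 0) 0 θ| ≤ curveJetBar cc cc' U 0 0) ∧
      TwoLegReadOscAt L M c'' β U μ (klFlowFrameU L M β U μ 0) 0 := by
  refine ⟨fun θ => ?_, twoLegReadOscAt_zero_of_structured hcont hA hfit''⟩
  rw [klFlowFrameU_zero]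
  refine abs_klLocalPart_le_curveJetBar_zero_of_structured_table (cc := cc) (cc' := cc') τ (by simpa using hτ) (fun θ => ?_) θ
  rw [C4a.klLocalPart_zero_frame_eq_profile β U μ θ]
  calc _ ≤ a * U ^ 2 := hA θ
    _ ≤ cc' 0 * U ^ 2 := mul_le_mul_of_nonneg_right hfit (sq_nonneg U)
    _ = cc' 0 * U ^ 2 * (4 : ℝ) ^ (-2 * ((0 : ℕ) : ℤ)) := by norm_num

end Model

end Summit.HubbardSuperconductivity.HubbardSuperconductivity.Theorems.KLRegimeSplit

end
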